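import Summits.ValiantsHypothesis.ValiantsHypothesis.Theorems.NewtonUnitEquationsTwoProductsFormalLogLinearisationDefs

/-!
# Sub-box truncated-congruence cascade on the digit grid — val-idea-34 g10 (crux stmt-ValiantsHypothesis-5906)

Crux-workfile companion of the crux idea card `subbox-congruence-cascade` (T-γ (γ1) of record: every factor
supported on `{0} ∪ A_s`, `A_s = {2^a e₁ + 2^b e₂ : a, b < s}`, `t − 1 = s²`).

KERNEL FACTS (0 sorry): `truncatedCongruence_holds : TruncatedCongruence` — below an LL-visible vertex `p`
(strict `ξ`-top, `ξ` in the open negative quadrant) every coordinate box `[0,N) × [0,M)` under `p` and missing `p`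
is an IDENTITY BOX: `∏(1 + u_j^B) ≡ ∏(1 + v_j^B) mod (X^N, Y^M)`; `congruenceDownward_holds : CongruenceDownward` —
identity boxes form a down-set. Support-free, padding-robust (a padded factor `u_j = 0` truncates to `0`).

TYPED TARGETS (defs only, OPEN): `DigitGridTwoProducts` = `TwoProducts` verbatim restricted to `{0} ∪ A_s`
supports (the γ1 statement of record, residual currency); `DigitGridLLLaw` = the cascade's conjectured output at
the lacunary (LL) corner, first-order shape `C·m^c·s²`, NOT t-free; rev 2 adds the (U1) carry-free targets
`CarryFreeDigitGridTwoProducts` / `CarryFreeLLLaw` (base `β ≥ m+1`, VERDICT #25).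

Honest frame: bookkeeping + one exact lemma; `TwoProducts` / `PlanarCellBound` / `ResidualLawV25` / `closes`
UNMOVED (v25 @c11a592d1404, 1 sorry `stub_residual`). VP ≠ VNP is NOT proved.
-/

set_option linter.dupNamespace false

namespace Summit.ValiantsHypothesis.ValiantsHypothesis.Cruxes.TwoProducts.SubboxCascade

open MvPolynomial
open scoped BigOperators
open Summit.ValiantsHypothesis.ValiantsHypothesis.Theorems.NewtonUnitEquations.TwoProducts.FormalLogLinearisation

/-- Box truncation: keep exactly the monomials whose exponent lies in the coordinate box `[0,N) × [0,M)`. -/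
noncomputable def boxTrunc (N M : ℕ) (p : MvPolynomial (Fin 2) ℂ) : MvPolynomial (Fin 2) ℂ :=
  ∑ e ∈ p.support.filter (fun e => e 0 < N ∧ e 1 < M), monomial e (coeff e p)

/-- (D2, first lemma) TRUNCATED CONGRUENCE. If `p` is the strict `ξ`-top of `supp(∏(1+u_j) − ∏(1+v_j))` for a
weight `ξ` in the OPEN negative quadrant, then for every coordinate box `B = [0,N) × [0,M)` lying below `p`
(`N ≤ p₀ + 1`, `M ≤ p₁ + 1`) and missing `p` (`N ≤ p₀ ∨ M ≤ p₁`), the box-truncated instance is an identity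
INSIDE the box. (On γ1 the cascade uses `N = 2^{a*}`, `M = 2^{b*}`, the dyadic class of `p`.) [this file] -/
def TruncatedCongruence : Prop :=
  ∀ (m : ℕ) (u v : Fin m → MvPolynomial (Fin 2) ℂ) (p : Expo) (ξ : Fin 2 → ℝ),
    ξ 0 < 0 → ξ 1 < 0 → IsStrictTop ξ (↑(tailDiff u v).support : Set Expo) p →
    ∀ N M : ℕ, N ≤ p 0 + 1 → M ≤ p 1 + 1 → (N ≤ p 0 ∨ M ≤ p 1) →
    ∀ x : Expo, x 0 < N → x 1 < M →
      coeff x (tailDiff (fun j => boxTrunc N M (u j)) (fun j => boxTrunc N M (v j))) = 0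

/-- (D2, bookkeeping) identity boxes form a DOWN-SET: a congruence on `[0,N) × [0,M)` restricts to every smaller
box. [this file] -/
def CongruenceDownward : Prop :=
  ∀ (m : ℕ) (u v : Fin m → MvPolynomial (Fin 2) ℂ) (N M N' M' : ℕ), N' ≤ N → M' ≤ M →
    (∀ x : Expo, x 0 < N → x 1 < M →
      coeff x (tailDiff (fun j => boxTrunc N M (u j)) (fun j => boxTrunc N M (v j))) = 0) →
    ∀ x : Expo, x 0 < N' → x 1 < M' →
      coeff x (tailDiff (fun j => boxTrunc N' M' (u j)) (fun j => boxTrunc N' M' (v j))) = 0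

/-- Coefficients of the box truncation. -/
theorem coeff_boxTrunc (N M : ℕ) (p : MvPolynomial (Fin 2) ℂ) (x : Expo) :
    coeff x (boxTrunc N M p) = if x 0 < N ∧ x 1 < M then coeff x p else 0 := by
  classical
  unfold boxTrunc
  rw [coeff_sum]
  simp only [coeff_monomial]
  rw [Finset.sum_ite_eq' (p.support.filter (fun e => e 0 < N ∧ e 1 < M)) x (fun e => coeff e p)]
  simp only [Finset.mem_filter, MvPolynomial.mem_support_iff]
  by_cases hx : x 0 < N ∧ x 1 < M
  · by_cases hc : coeff x p = 0
    · simp [hx, hc]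
    · simp [hx, hc]
  · simp [hx]

/-- In the box, `1 + boxTrunc u` and `1 + u` have the same coefficients. -/
theorem coeff_one_add_boxTrunc (N M : ℕ) (q : MvPolynomial (Fin 2) ℂ) (x : Expo)
    (hx0 : x 0 < N) (hx1 : x 1 < M) :
    coeff x (1 + boxTrunc N M q) = coeff x (1 + q) := by
  rw [coeff_add, coeff_add, coeff_boxTrunc]
  simp [hx0, hx1]

/-- Products are congruent modulo the box-complement ideal: if two finite families agree coefficientwise inside
the box `[0,N) × [0,M)`, so do their products (exponents are componentwise additive and nonnegative). -/
theorem coeff_prod_box_congr {m : ℕ} (N M : ℕ) (F G : Fin m → MvPolynomial (Fin 2) ℂ)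
    (h : ∀ j, ∀ x : Expo, x 0 < N → x 1 < M → coeff x (F j) = coeff x (G j)) :
    ∀ (s : Finset (Fin m)) (x : Expo), x 0 < N → x 1 < M →
      coeff x (∏ j ∈ s, F j) = coeff x (∏ j ∈ s, G j) := by
  classical
  intro s
  induction s using Finset.induction_on with
  | empty => intro x _ _; simp
  | insert a s ha ih =>
    intro x hx0 hx1
    rw [Finset.prod_insert ha, Finset.prod_insert ha, coeff_mul, coeff_mul]
    apply Finset.sum_congr rfl
    intro ab hab
    rw [Finset.HasAntidiagonal.mem_antidiagonal] at hab
    have h0 : ab.1 0 + ab.2 0 = x 0 := by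
      have := congrArg (fun e : Expo => e 0) hab
      simpa [Finsupp.add_apply] using this
    have h1 : ab.1 1 + ab.2 1 = x 1 := by
      have := congrArg (fun e : Expo => e 1) hab
      simpa [Finsupp.add_apply] using this
    rw [h a ab.1 (by omega) (by omega), ih ab.2 (by omega) (by omega)]

/-- The truncated difference of products agrees with the original one inside the box. -/
theorem coeff_tailDiff_boxTrunc {m : ℕ} (N M : ℕ) (u v : Fin m → MvPolynomial (Fin 2) ℂ) (x : Expo)
    (hx0 : x 0 < N) (hx1 : x 1 < M) :
    coeff x (tailDiff (fun j => boxTrunc N M (u j)) (fun j => boxTrunc N M (v j))) =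
      coeff x (tailDiff u v) := by
  unfold tailDiff
  rw [coeff_sub, coeff_sub]
  have hu := coeff_prod_box_congr N M (fun j => 1 + boxTrunc N M (u j)) (fun j => 1 + u j)
    (fun j y hy0 hy1 => coeff_one_add_boxTrunc N M (u j) y hy0 hy1) Finset.univ x hx0 hx1
  have hv := coeff_prod_box_congr N M (fun j => 1 + boxTrunc N M (v j)) (fun j => 1 + v j)
    (fun j y hy0 hy1 => coeff_one_add_boxTrunc N M (v j) y hy0 hy1) Finset.univ x hx0 hx1
  rw [hu, hv]

/-- Two truncations agree inside the smaller box. -/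
theorem coeff_tailDiff_boxTrunc_mono {m : ℕ} (N M N' M' : ℕ) (hN : N' ≤ N) (hM : M' ≤ M)
    (u v : Fin m → MvPolynomial (Fin 2) ℂ) (x : Expo) (hx0 : x 0 < N') (hx1 : x 1 < M') :
    coeff x (tailDiff (fun j => boxTrunc N' M' (u j)) (fun j => boxTrunc N' M' (v j))) =
      coeff x (tailDiff (fun j => boxTrunc N M (u j)) (fun j => boxTrunc N M (v j))) := by
  rw [coeff_tailDiff_boxTrunc N' M' u v x hx0 hx1,
    coeff_tailDiff_boxTrunc N M u v x (lt_of_lt_of_le hx0 hN) (lt_of_lt_of_le hx1 hM)]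

/-- KERNEL FACT: identity boxes form a down-set. -/
theorem congruenceDownward_holds : CongruenceDownward := by
  intro m u v N M N' M' hN hM hbox x hx0 hx1
  rw [coeff_tailDiff_boxTrunc_mono N M N' M' hN hM u v x hx0 hx1]
  exact hbox x (lt_of_lt_of_le hx0 hN) (lt_of_lt_of_le hx1 hM)

/-- KERNEL FACT (D2 first lemma): the truncated congruence below an LL-visible vertex. -/
theorem truncatedCongruence_holds : TruncatedCongruence := by
  intro m u v p ξ hξ0 hξ1 htop N M hN hM hmiss x hx0 hx1
  rw [coeff_tailDiff_boxTrunc N M u v x hx0 hx1]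
  -- `x` lies coordinatewise below `p` and differs from it, so its weight is ≥ that of `p`; a strict top forbids it.
  have hxp0 : x 0 ≤ p 0 := by omega
  have hxp1 : x 1 ≤ p 1 := by omega
  have hne : x ≠ p := by
    intro hxp
    subst hxp
    rcases hmiss with h | h <;> omega
  by_contra hc
  have hxS : x ∈ (↑(tailDiff u v).support : Set Expo) := by
    rw [Finset.mem_coe, MvPolynomial.mem_support_iff]
    exact hc
  have hlt := htop.2 x hxS hne
  unfold wt at hlt
  have c0 : ((x 0 : ℕ) : ℝ) ≤ ((p 0 : ℕ) : ℝ) := by exact_mod_cast hxp0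
  have c1 : ((x 1 : ℕ) : ℝ) ≤ ((p 1 : ℕ) : ℝ) := by exact_mod_cast hxp1
  nlinarith [mul_le_mul_of_nonpos_left c0 hξ0.le, mul_le_mul_of_nonpos_left c1 hξ1.le]

/-- The digit grid `A_s = {2^a e₁ + 2^b e₂ : a, b < s}` (T-γ (γ1) alphabet of record). -/
def DigitGrid (s : ℕ) : Set Expo :=
  {e | ∃ a b : ℕ, a < s ∧ b < s ∧ e 0 = 2 ^ a ∧ e 1 = 2 ^ b}

/-- LL-VISIBLE points: visible vertices exposed from the OPEN negative quadrant (the origin corner of the cell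
complex; on γ1 the lacunary corner, where the geometric ceiling `LL ≈ s^{(m+1)/2}/√((m−1)!)` is super-currency —
CEILING-TABLE f00f4ea2baa7e93f, READOUT j321871). -/
def llVisible {m : ℕ} (u v : Fin m → MvPolynomial (Fin 2) ℂ) : Set Expo :=
  {l | ∃ ξ : Fin 2 → ℝ, ξ 0 < 0 ∧ ξ 1 < 0 ∧ ValidWeight u v ξ ∧
    IsStrictTop ξ (↑(tailDiff u v).support : Set Expo) l}

/-- (D1 target, the named toy) `TwoProducts` VERBATIM restricted to factors supported on `{0} ∪ A_s` (so
`t = s² + 1`): the T-γ (γ1) statement of record in the residual currency `2^{am}(t+2)^b`. A consequence of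
`TwoProducts`; OPEN; print gives `k·t^{2m/3}` (KPTT arXiv:1308.2286 Thm 6) and nothing class-specific. -/
def DigitGridTwoProducts : Prop :=
  ∃ a b : ℕ, ∀ (m s : ℕ) (f g : Fin m → MvPolynomial (Fin 2) ℂ),
    (∀ j, ∀ e ∈ (f j).support, e = 0 ∨ e ∈ DigitGrid s) →
    (∀ j, ∀ e ∈ (g j).support, e = 0 ∨ e ∈ DigitGrid s) →
    (Set.extremePoints ℝ (convexHull ℝ ((fun e : Fin 2 →₀ ℕ => fun i : Fin 2 => ((e i : ℕ) : ℝ)) ''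
      ((∏ j, f j - ∏ j, g j).support : Set (Fin 2 →₀ ℕ))))).ncard ≤ 2 ^ (a * m) * (s ^ 2 + 2) ^ b

/-- (D1, LL corner — the cascade's CONJECTURED output) on γ1 tails the number of LL-visible points is at most
`C · m^c · s²`: first-order shape (`FO = 2·m·s²`), uniform in `s`, NOT t-free (toyU-consistent, V#24 (5)). -/
def DigitGridLLLaw : Prop :=
  ∃ C c : ℕ, ∀ (m s : ℕ) (u v : Fin m → MvPolynomial (Fin 2) ℂ),
    (∀ j, ∀ e ∈ (u j).support, e ∈ DigitGrid s) → (∀ j, ∀ e ∈ (v j).support, e ∈ DigitGrid s) →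
    (llVisible u v).ncard ≤ C * m ^ c * s ^ 2

/-! ## rev 2 (after val-idea-crit-8 g3 VERDICT #25, KEEP-γ ★★): the (U1) upgrade target typed — the CARRY-FREE class -/

/-- The base-`β` digit grid `{β^a e₁ + β^b e₂ : a, b < s}` (`β = 2` is `DigitGrid s`; for `β ≥ m+1` no `≤ m`-fold digit sum
carries, and identity boxes force row coincidence — VERDICT #25 check (b), «banked true»). -/
def DigitGridB (β s : ℕ) : Set Expo :=
  {e | ∃ a b : ℕ, a < s ∧ b < s ∧ e 0 = β ^ a ∧ e 1 = β ^ b}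

/-- (U1, D1 toy isolating the COUNT from the carry problem) `TwoProducts` VERBATIM on factors supported on `{0} ∪ A_s^{(β)}`
with `β ≥ m + 1` (carry-free): rigidity below every LL-visible point is a theorem there (paper), only the inter-piece count of
the hook expansion remains. OPEN; in crux currency `2^{am}(s²+2)^b`; not t-free, not m-free. -/
def CarryFreeDigitGridTwoProducts : Prop :=
  ∃ a b : ℕ, ∀ (m s β : ℕ) (f g : Fin m → MvPolynomial (Fin 2) ℂ), m + 1 ≤ β →
    (∀ j, ∀ e ∈ (f j).support, e = 0 ∨ e ∈ DigitGridB β s) →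
    (∀ j, ∀ e ∈ (g j).support, e = 0 ∨ e ∈ DigitGridB β s) →
    (Set.extremePoints ℝ (convexHull ℝ ((fun e : Fin 2 →₀ ℕ => fun i : Fin 2 => ((e i : ℕ) : ℝ)) ''
      ((∏ j, f j - ∏ j, g j).support : Set (Fin 2 →₀ ℕ))))).ncard ≤ 2 ^ (a * m) * (s ^ 2 + 2) ^ b

/-- (U1, LL corner) the carry-free LL law in COUNTING SHAPE (VERDICT #25 (L-ii): law shape = counting shape `C·m^c·s²`;
a kill takes a fixed-`m` family with `#llVisible ≥ s^{2+ε}`, not `s^{1+ε}`). Tails version (`u_j = f_j − 1`, constant `1`). -/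
def CarryFreeLLLaw : Prop :=
  ∃ C c : ℕ, ∀ (m s β : ℕ) (u v : Fin m → MvPolynomial (Fin 2) ℂ), m + 1 ≤ β →
    (∀ j, ∀ e ∈ (u j).support, e ∈ DigitGridB β s) → (∀ j, ∀ e ∈ (v j).support, e ∈ DigitGridB β s) →
    (llVisible u v).ncard ≤ C * m ^ c * s ^ 2

/-! ## rev 3 (same session, after computing carry-free GEOMETRIC ceilings exactly — seat note N4):
the carry-free LL corner looks GEOMETRICALLY capped (linear in `s` at fixed `m`: `3s−4` for `m = 2` up to `s = 14`,
`7s−15` for `m = 3`, large base), so `(U1)` may be decided by geometry alone; the two statements that make this precise,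
and the conditional count `(U1′)` that isolates the cascade's count mechanism INSIDE base 2. All OPEN. -/

/-- `k`-fold sums (1 ≤ k ≤ m) of base-`β` digit-grid letters: the only exponents a difference of two products of `m`
factors supported on `{0} ∪ A_s^{(β)}` can have (besides `0`). -/
def DigitSums (β s m : ℕ) : Set Expo :=
  {e | ∃ k : ℕ, 1 ≤ k ∧ k ≤ m ∧ ∃ w : Fin k → Expo, (∀ i, w i ∈ DigitGridB β s) ∧ e = ∑ i, w i}

/-- CONJECTURE G (carry-free geometric ceiling, seat note N4): for `β ≥ m+1` EVERY subset of the `≤ m`-fold digit sums has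
at most `C·m^c·s` lower-left hull vertices (strict tops from the open negative quadrant). Exact data (val-idea-34 g10,
`g10/llfast.py`): large base `m=2: 3s−4 (s ≤ 14)`, `m=3: 20,27,34 (s=5,6,7)`, `m=4: 11,20,33 (s=3,4,5)`, `m=5: 16,30`;
`β = m+1`: `m=2: 4s−9 (s ≤ 14)`, `m=3: 8,14,21,30,38`. PROVED part (paper, formal limit `β → ∞`): edge levels are
non-decreasing along the chain and generic-scale directions see `≤ (2s+1)(|F_m|+1)` vertices, `|F_m| = #{p/q : p,q ≤ m}`;
the infinitesimally-tied directions are the unproved remainder. If G holds with `m^c` (even `2^{O(m)}`), `CarryFreeLLLaw`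
follows with NO cancellation analysis, i.e. `(U1)` cannot test the count mechanism. -/
def CarryFreeGeometricCeiling : Prop :=
  ∃ C c : ℕ, ∀ (β s m : ℕ) (S : Set Expo), m + 1 ≤ β → S ⊆ DigitSums β s m →
    {p | ∃ ξ : Fin 2 → ℝ, ξ 0 < 0 ∧ ξ 1 < 0 ∧ IsStrictTop ξ S p}.ncard ≤ C * m ^ c * s

/-- Row coincidence below every LL-visible point: for each LL-visible `p` and every coordinate box strictly below it in
one direction, the truncated rows agree AS MULTISETS (what UFD gives for free when `β ≥ m+1`; in base 2 it is the
conjectured rigidity, true only up to the thick hook — so this hypothesis IDEALISES base 2). -/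
def RowCoincidenceBelowLL {m : ℕ} (u v : Fin m → MvPolynomial (Fin 2) ℂ) : Prop :=
  ∀ p ∈ llVisible u v, ∀ N M : ℕ, N ≤ p 0 + 1 → M ≤ p 1 + 1 → (N ≤ p 0 ∨ M ≤ p 1) →
    (Finset.univ.val.map fun j => boxTrunc N M (u j)) = (Finset.univ.val.map fun j => boxTrunc N M (v j))

/-- `(U1′)` — the count mechanism isolated INSIDE base 2 (where the geometric ceiling is super-currency in `m`,
CEILING-TABLE f00f4ea2baa7e93f): assuming row coincidence below LL-visible points, the LL count has counting shape.
This is exactly what the hook expansion + slab / leading-form analysis of the card must deliver. OPEN. -/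
def DigitGridLLLawGivenRigidity : Prop :=
  ∃ C c : ℕ, ∀ (m s : ℕ) (u v : Fin m → MvPolynomial (Fin 2) ℂ),
    (∀ j, ∀ e ∈ (u j).support, e ∈ DigitGrid s) → (∀ j, ∀ e ∈ (v j).support, e ∈ DigitGrid s) →
    RowCoincidenceBelowLL u v → (llVisible u v).ncard ≤ C * m ^ c * s ^ 2

/-- rev 4: the LL law SHARPENED to linear-in-`s` (licensed by val-idea-crit-8 g3's 01:48:17Z correction — counting at LL
buys only `≈ 1.7·s·√m` — and by note N4: base-2 geometric LL ceiling is `4s−9` for `m = 2` but `s²−3s+6` for `m = 3`, so for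
`m ≥ 3` a linear law has content against geometry). Kill: a fixed-`m` γ1 family with `#llVisible ≥ c·s^{1+ε}`. OPEN. -/
def DigitGridLLLawLinear : Prop :=
  ∃ C c : ℕ, ∀ (m s : ℕ) (u v : Fin m → MvPolynomial (Fin 2) ℂ),
    (∀ j, ∀ e ∈ (u j).support, e ∈ DigitGrid s) → (∀ j, ∀ e ∈ (v j).support, e ∈ DigitGrid s) →
    (llVisible u v).ncard ≤ C * m ^ c * s

theorem digitGridLLLaw_of_linear (h : DigitGridLLLawLinear) : DigitGridLLLaw := by
  obtain ⟨C, c, hC⟩ := h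
  refine ⟨C, c, fun m s u v hu hv => (hC m s u v hu hv).trans ?_⟩
  rcases Nat.eq_zero_or_pos s with rfl | hs
  · simp
  · exact Nat.mul_le_mul_left _ (by nlinarith)

end Summit.ValiantsHypothesis.ValiantsHypothesis.Cruxes.TwoProducts.SubboxCascade
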